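import Literature.NumberTheory.Automorphic.KimExteriorSquareGL4ArchimedeanTwist
import Literature.NumberTheory.Automorphic.AutomorphicRepsGL
import HarnessLib

/-!
# An infinity type from local integral pairings at the complex places
(crux `IrreducibilityBySelfDuality.RegularTwistCM`, item stmt-Langlands-14069, line
`petersson-hermitian-purity`, stub `stub_infinityTypeOfLocalPairing`)

Let `π = W / W'` be an automorphic representation datum on `GL₂(𝔸_K)` (Borel–Jacquet) with archimedean
(Harish-Chandra) parameter `χ : (K →+* ℂ) → Multiset ℂ`. Suppose that at every COMPLEX place `w` of `K`
the parameters at the two embeddings over `w` pair integrally: `χ(σ_w) = {a₁, a₂}`,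
`χ(σ̄_w) = {b₁, b₂}` with `a₁ - b₁ ∈ ℤ`, `a₂ - b₂ ∈ ℤ`. Then `π` has a well-formed infinity type
(`AutomorphicRepData.exists_hasInfinityType`), namely

* at a real place (`σ = σ̄`): the diagonal weights `{(a, a) : a ∈ χ σ}` (swap-invariant);
* at a complex place `w`: `T(σ_w) = {(a₁, b₁), (a₂, b₂)}` and `T(σ̄_w) = {(b₁, a₁), (b₂, a₂)}`.

This is the bookkeeping half of Clozel's "type à l'infini" (Clozel 1990, §3.3; Buzzard–Gee 2014, §3.1):
the integrality `a_i - b_i ∈ ℤ` is exactly the side condition `ArchWeight.exists_int_sub`, and the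
compatibility `T(σ̄) = swap T(σ)` is `InfinityType.IsWellFormed`. The analytic content (that the local
pairing exists, from the `(𝔤, K)`-module structure of `W / W'` at a complex place) is NOT here: it is the
hypothesis `hpair`, produced by the sibling stubs of the line.

References: L. Clozel, *Motifs et formes automorphes* (1990), §3.3 [Clozel1990]; K. Buzzard, T. Gee
(2014), §3.1 [BuzzardGee2014].
-/

-- `Summit.Langlands.Langlands.…` (problem = summit name, D-0017 layout) trips `dupNamespace` on every declaration;
-- the lakefile sets the same option for the `Summits` library.
set_option linter.dupNamespace false

noncomputable section

open scoped Classical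
open NumberField NumberField.InfinitePlace
open Literature.NumberTheory.Automorphic

namespace Summit.Langlands.Langlands.Theorems.RegularTwistCM

/-- `conj ∘ conj ∘ σ = σ` for a complex embedding `σ` (complex conjugation is an involution). [folklore] -/
theorem conjugate_conjugate_eq {K : Type} [Field K] (σ : K →+* ℂ) :
    ComplexEmbedding.conjugate (ComplexEmbedding.conjugate σ) = σ :=
  ComplexEmbedding.involutive_conjugate K σ

/-- At a complex place `w`, the conjugate of the chosen embedding is a different embedding. [folklore] -/
theorem conjugate_embedding_ne_of_isComplex {K : Type} [Field K] {w : InfinitePlace K}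
    (hw : w.IsComplex) : ComplexEmbedding.conjugate w.embedding ≠ w.embedding := fun h =>
  (isComplex_iff.mp hw) (ComplexEmbedding.isReal_iff.mpr h)

/-- Every complex embedding `σ` of a number field is either real (defines a real place), or is one of
the two embeddings `σ_w`, `σ̄_w` over a complex place `w`. [folklore] -/
theorem isReal_mk_or_exists_isComplex {K : Type} [Field K] (σ : K →+* ℂ) :
    (InfinitePlace.mk σ).IsReal ∨ ∃ w : {w : InfinitePlace K // w.IsComplex},
      σ = w.1.embedding ∨ σ = ComplexEmbedding.conjugate w.1.embedding := by
  rcases (InfinitePlace.mk σ).isReal_or_isComplex with h | h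
  · exact Or.inl h
  · refine Or.inr ⟨⟨InfinitePlace.mk σ, h⟩, ?_⟩
    rcases mk_eq_iff.mp (mk_embedding (InfinitePlace.mk σ)) with h' | h'
    · exact Or.inl h'.symm
    · exact Or.inr h'.symm

/-- C4 (bookkeeping; Clozel 1990, §3.3 "type à l'infini"): if the archimedean parameter `χ` of a rank-2
datum pairs integrally at every complex place, `χ(σ_w) = {a₁, a₂}`, `χ(σ̄_w) = {b₁, b₂}`,
`a_i - b_i ∈ ℤ`, then the datum has a (well-formed) infinity type: at a real place the diagonal
weights `a ↦ (a, a)`, at a complex place `w` the weights `{(a₁, b₁), (a₂, b₂)}` at `σ_w` and their swaps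
at `σ̄_w`. [cite: Clozel1990, §3.3] -/
theorem stub_infinityTypeOfLocalPairing {K : Type} [Field K] [NumberField K]
    {hcpt : isCompact_glFiniteIntegralLevel 2 K}
    (π : AutomorphicRepData (AutomorphyDatum.gl 2 K hcpt)) (χ : (K →+* ℂ) → Multiset ℂ)
    (hχ : π.HasArchParameter χ)
    (hpair : ∀ w : {w : InfinitePlace K // w.IsComplex}, ∃ a₁ a₂ b₁ b₂ : ℂ,
      χ w.1.embedding = {a₁, a₂} ∧ χ (ComplexEmbedding.conjugate w.1.embedding) = {b₁, b₂} ∧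
      (∃ k : ℤ, a₁ - b₁ = k) ∧ (∃ l : ℤ, a₂ - b₂ = l)) :
    π.exists_hasInfinityType := by
  classical
  choose a₁ a₂ b₁ b₂ hχe hχc hk hl using hpair
  -- the paired weights `{(a₁, b₁), (a₂, b₂)}` at a complex place `w`
  let P : {w : InfinitePlace K // w.IsComplex} → Multiset ArchWeight := fun w =>
    {⟨a₁ w, b₁ w, hk w⟩, ⟨a₂ w, b₂ w, hl w⟩}
  have hPa : ∀ w, (P w).map ArchWeight.a = χ w.1.embedding := fun w => by
    rw [hχe w]
    simp [P]
  have hPb : ∀ w, ((P w).map ArchWeight.swap).map ArchWeight.a =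
      χ (ComplexEmbedding.conjugate w.1.embedding) := fun w => by
    rw [hχc w, Multiset.map_map]
    simp [P]
  -- the diagonal weight `a ↦ (a, a)` (real places)
  let diag : ℂ → ArchWeight := fun x => ⟨x, x, 0, by simp⟩
  let T : InfinityType K 2 := fun σ =>
    if hw : (InfinitePlace.mk σ).IsComplex then
      (if σ = (InfinitePlace.mk σ).embedding then P ⟨InfinitePlace.mk σ, hw⟩
        else (P ⟨InfinitePlace.mk σ, hw⟩).map ArchWeight.swap)
    else (χ σ).map diag
  have hTc : ∀ (σ : K →+* ℂ) (w : InfinitePlace K) (hw : w.IsComplex), InfinitePlace.mk σ = w →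
      T σ = if σ = w.embedding then P ⟨w, hw⟩ else (P ⟨w, hw⟩).map ArchWeight.swap := by
    rintro σ w hw rfl
    exact dif_pos hw
  have hTr : ∀ σ : K →+* ℂ, (InfinitePlace.mk σ).IsReal → T σ = (χ σ).map diag := fun σ hσ =>
    dif_neg (not_isComplex_iff_isReal.mpr hσ)
  have hTe : ∀ w : {w : InfinitePlace K // w.IsComplex}, T w.1.embedding = P w := fun w => by
    rw [hTc w.1.embedding w.1 w.2 (mk_embedding w.1), if_pos rfl]
  have hTce : ∀ w : {w : InfinitePlace K // w.IsComplex},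
      T (ComplexEmbedding.conjugate w.1.embedding) = (P w).map ArchWeight.swap := fun w => by
    rw [hTc (ComplexEmbedding.conjugate w.1.embedding) w.1 w.2
      (by rw [mk_conjugate_eq, mk_embedding]), if_neg (conjugate_embedding_ne_of_isComplex w.2)]
  refine ⟨T, ⟨fun σ => ?_, fun σ => ?_⟩, ?_⟩
  · -- exactly two weights at every embedding
    rcases isReal_mk_or_exists_isComplex σ with h | ⟨w, rfl | rfl⟩
    · rw [hTr σ h, Multiset.card_map]
      exact AutomorphicRepData.card_eq_of_hasArchParameter hχ σ
    · rw [hTe]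
      exact Multiset.card_pair _ _
    · rw [hTce, Multiset.card_map]
      exact Multiset.card_pair _ _
  · -- compatibility with complex conjugation
    rcases isReal_mk_or_exists_isComplex σ with h | ⟨w, rfl | rfl⟩
    · have hσ : ComplexEmbedding.conjugate σ = σ :=
        ComplexEmbedding.isReal_iff.mp (isReal_mk_iff.mp h)
      rw [hσ, hTr σ h, Multiset.map_map]
      rfl
    · rw [hTce, hTe]
    · rw [conjugate_conjugate_eq, hTe, hTce]
      simp only [Multiset.map_map, Function.comp_def, ArchWeight.swap_swap, Multiset.map_id']
  · -- the `a`-exponents are the archimedean parameter `χ`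
    have hfun : (fun σ => (T σ).map ArchWeight.a) = χ := by
      funext σ
      rcases isReal_mk_or_exists_isComplex σ with h | ⟨w, rfl | rfl⟩
      · rw [hTr σ h, Multiset.map_map]
        exact Multiset.map_id' _
      · rw [hTe, hPa]
      · rw [hTce, hPb]
    rw [hfun]
    exact hχ

end Summit.Langlands.Langlands.Theorems.RegularTwistCM

end
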